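import Mathlib.LinearAlgebra.Matrix.GeneralLinearGroup.Defs
import Mathlib.LinearAlgebra.Matrix.SchurComplement
import Mathlib.LinearAlgebra.Matrix.Reindex
import Mathlib.GroupTheory.Index
import HarnessLib

/-!
# Maximal parabolic subgroups of `GL(V₁ ⊕ V₂)`: block upper triangular matrices

Topic `Literature/RepresentationTheory/FiniteGroups` (used for the Harish-Chandra reduction of
character degrees of `GL_n(𝔽_q)`, file `GLnCharacterDegreeBound`).  For a commutative ring `F`
and finite index types `m₁`, `m₂`, inside `G = GL(m₁ ⊕ m₂, F)` (invertible matrices indexed by the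
sum type, written in `2 × 2` block form `(A B; C D)` with Mathlib's `Matrix.fromBlocks` /
`Matrix.toBlocksᵢⱼ`):

* `GLBlock.parabolic F m₁ m₂` — the **standard maximal parabolic subgroup** `P = {(A B; 0 D)}`
  (lower-left block `C = 0`);
* `GLBlock.levi` — the **Levi projection** `P →* GL(m₁, F) × GL(m₂, F)`, `(A B; 0 D) ↦ (A, D)`
  (the diagonal blocks of an invertible block-triangular matrix are invertible,
  Mathlib `Matrix.isUnit_fromBlocks_zero₂₁`); it is surjective (`levi_surjective`) and its kernel is
  the **unipotent radical** `U = {(1 B; 0 1)}` (`mem_ker_levi_iff`), in bijection with the matrices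
  `B` (`kerLeviEquiv`), so `|U| = |F|^{|m₁| |m₂|}` (`card_ker_levi`) and
  `|P| = |F|^{|m₁||m₂|} · |GL(m₁, F)| · |GL(m₂, F)|` (`card_parabolic`);
* `GLBlock.reindex e : GL(m, F) ≃* GL(m', F)` — transport along a bijection of index types
  (Mathlib `Matrix.reindexAlgEquiv` on units), to pass between `Fin k ⊕ Fin (n - k)` and `Fin n`.

Standard material: Borel, *Linear Algebraic Groups*, §11; Carter, *Finite Groups of Lie Type*,
§2.6 (parabolic subgroups `P_J = L_J U_J` of `GL_n`); Digne–Michel, *Representations of Finite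
Groups of Lie Type*, Ch. 1–2.  Everything here is definitional bookkeeping and is proved.

## What is NOT here

General (non-maximal) standard parabolics `P_{(n₁,…,n_r)}` and flags; the Bruhat decomposition;
conjugacy of parabolics.  Only the two-block case is needed for the maximal-parabolic induction.
-/

noncomputable section

open Matrix

namespace Literature.RepresentationTheory.FiniteGroups

namespace GLBlock

variable (F : Type*) [CommRing F] (m₁ m₂ : Type*) [Fintype m₁] [Fintype m₂] [DecidableEq m₁]
  [DecidableEq m₂]

/-- The **standard maximal parabolic subgroup** of `GL(m₁ ⊕ m₂, F)`: invertible matrices whose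
lower-left block vanishes, `P = {(A B; 0 D)}` (Carter, *Finite Groups of Lie Type*, §2.6;
Borel, *Linear Algebraic Groups*, §11). [folklore] -/
def parabolic : Subgroup (GL (m₁ ⊕ m₂) F) where
  carrier := {g | ((g : GL (m₁ ⊕ m₂) F) : Matrix (m₁ ⊕ m₂) (m₁ ⊕ m₂) F).toBlocks₂₁ = 0}
  mul_mem' := by
    intro g h hg hh
    simp only [Set.mem_setOf_eq] at hg hh ⊢
    rw [Matrix.GeneralLinearGroup.coe_mul, ← fromBlocks_toBlocks (g : Matrix (m₁ ⊕ m₂) (m₁ ⊕ m₂) F),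
      ← fromBlocks_toBlocks (h : Matrix (m₁ ⊕ m₂) (m₁ ⊕ m₂) F), hg, hh, fromBlocks_multiply]
    simp
  one_mem' := by
    simp only [Set.mem_setOf_eq]
    rw [Matrix.GeneralLinearGroup.coe_one, ← fromBlocks_one, toBlocks_fromBlocks₂₁]
  inv_mem' := by
    intro g hg
    simp only [Set.mem_setOf_eq] at hg ⊢
    have hu : IsUnit (g : Matrix (m₁ ⊕ m₂) (m₁ ⊕ m₂) F) := Units.isUnit g
    rw [← fromBlocks_toBlocks (g : Matrix (m₁ ⊕ m₂) (m₁ ⊕ m₂) F), hg] at hu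
    have hAD := isUnit_fromBlocks_zero₂₁.mp hu
    rw [Matrix.GeneralLinearGroup.coe_inv, ← fromBlocks_toBlocks (g : Matrix (m₁ ⊕ m₂) (m₁ ⊕ m₂) F),
      hg, inv_fromBlocks_zero₂₁_of_isUnit_iff _ _ _ (iff_of_true hAD.1 hAD.2)]
    simp

variable {F m₁ m₂}

/-- Membership in the parabolic: the lower-left block vanishes. [folklore] -/
theorem mem_parabolic_iff (g : GL (m₁ ⊕ m₂) F) :
    g ∈ parabolic F m₁ m₂ ↔ (g : Matrix (m₁ ⊕ m₂) (m₁ ⊕ m₂) F).toBlocks₂₁ = 0 :=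
  Iff.rfl

/-- Block form of an element of the parabolic: `g = (A B; 0 D)`. [folklore] -/
theorem coe_eq_fromBlocks (g : parabolic F m₁ m₂) :
    ((g : GL (m₁ ⊕ m₂) F) : Matrix (m₁ ⊕ m₂) (m₁ ⊕ m₂) F) =
      fromBlocks ((g : GL (m₁ ⊕ m₂) F) : Matrix (m₁ ⊕ m₂) (m₁ ⊕ m₂) F).toBlocks₁₁
        ((g : GL (m₁ ⊕ m₂) F) : Matrix (m₁ ⊕ m₂) (m₁ ⊕ m₂) F).toBlocks₁₂ 0
        ((g : GL (m₁ ⊕ m₂) F) : Matrix (m₁ ⊕ m₂) (m₁ ⊕ m₂) F).toBlocks₂₂ := by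
  conv_lhs => rw [← fromBlocks_toBlocks ((g : GL (m₁ ⊕ m₂) F) : Matrix (m₁ ⊕ m₂) (m₁ ⊕ m₂) F)]
  rw [(mem_parabolic_iff _).mp g.2]

/-- The diagonal blocks of an element of the parabolic are invertible
(Mathlib `Matrix.isUnit_fromBlocks_zero₂₁`). [folklore] -/
theorem isUnit_toBlocks (g : parabolic F m₁ m₂) :
    IsUnit ((g : GL (m₁ ⊕ m₂) F) : Matrix (m₁ ⊕ m₂) (m₁ ⊕ m₂) F).toBlocks₁₁ ∧
      IsUnit ((g : GL (m₁ ⊕ m₂) F) : Matrix (m₁ ⊕ m₂) (m₁ ⊕ m₂) F).toBlocks₂₂ := by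
  have hu : IsUnit ((g : GL (m₁ ⊕ m₂) F) : Matrix (m₁ ⊕ m₂) (m₁ ⊕ m₂) F) := Units.isUnit _
  rw [coe_eq_fromBlocks g] at hu
  exact isUnit_fromBlocks_zero₂₁.mp hu

/-- The upper-left blocks multiply: `(g h)₁₁ = g₁₁ h₁₁` on the parabolic. [folklore] -/
theorem toBlocks₁₁_mul (g h : parabolic F m₁ m₂) :
    (((g * h : parabolic F m₁ m₂) : GL (m₁ ⊕ m₂) F) : Matrix (m₁ ⊕ m₂) (m₁ ⊕ m₂) F).toBlocks₁₁ =
      ((g : GL (m₁ ⊕ m₂) F) : Matrix (m₁ ⊕ m₂) (m₁ ⊕ m₂) F).toBlocks₁₁ * ((h : GL (m₁ ⊕ m₂) F) : Matrix (m₁ ⊕ m₂) (m₁ ⊕ m₂) F).toBlocks₁₁ := by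
  rw [Subgroup.coe_mul, Matrix.GeneralLinearGroup.coe_mul, coe_eq_fromBlocks g, coe_eq_fromBlocks h,
    fromBlocks_multiply]
  simp

/-- The lower-right blocks multiply: `(g h)₂₂ = g₂₂ h₂₂` on the parabolic. [folklore] -/
theorem toBlocks₂₂_mul (g h : parabolic F m₁ m₂) :
    (((g * h : parabolic F m₁ m₂) : GL (m₁ ⊕ m₂) F) : Matrix (m₁ ⊕ m₂) (m₁ ⊕ m₂) F).toBlocks₂₂ =
      ((g : GL (m₁ ⊕ m₂) F) : Matrix (m₁ ⊕ m₂) (m₁ ⊕ m₂) F).toBlocks₂₂ * ((h : GL (m₁ ⊕ m₂) F) : Matrix (m₁ ⊕ m₂) (m₁ ⊕ m₂) F).toBlocks₂₂ := by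
  rw [Subgroup.coe_mul, Matrix.GeneralLinearGroup.coe_mul, coe_eq_fromBlocks g, coe_eq_fromBlocks h,
    fromBlocks_multiply]
  simp

variable (F m₁ m₂)

/-- The **Levi projection** `P →* GL(m₁, F) × GL(m₂, F)`, `(A B; 0 D) ↦ (A, D)` (Carter §2.6:
`P_J = L_J U_J` with `L_J ≅ GL_{n₁} × GL_{n₂}`). [folklore] -/
def levi : parabolic F m₁ m₂ →* GL m₁ F × GL m₂ F where
  toFun g := ((isUnit_toBlocks g).1.unit, (isUnit_toBlocks g).2.unit)
  map_one' := by
    refine Prod.ext (Units.ext ?_) (Units.ext ?_)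
    · rw [IsUnit.unit_spec]
      show (((1 : parabolic F m₁ m₂) : GL (m₁ ⊕ m₂) F) : Matrix (m₁ ⊕ m₂) (m₁ ⊕ m₂) F).toBlocks₁₁ = 1
      rw [Subgroup.coe_one, Matrix.GeneralLinearGroup.coe_one, ← fromBlocks_one, toBlocks_fromBlocks₁₁]
    · rw [IsUnit.unit_spec]
      show (((1 : parabolic F m₁ m₂) : GL (m₁ ⊕ m₂) F) : Matrix (m₁ ⊕ m₂) (m₁ ⊕ m₂) F).toBlocks₂₂ = 1
      rw [Subgroup.coe_one, Matrix.GeneralLinearGroup.coe_one, ← fromBlocks_one, toBlocks_fromBlocks₂₂]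
  map_mul' g h := by
    refine Prod.ext (Units.ext ?_) (Units.ext ?_)
    · rw [Prod.fst_mul, Units.val_mul, IsUnit.unit_spec, IsUnit.unit_spec, IsUnit.unit_spec]
      exact toBlocks₁₁_mul g h
    · rw [Prod.snd_mul, Units.val_mul, IsUnit.unit_spec, IsUnit.unit_spec, IsUnit.unit_spec]
      exact toBlocks₂₂_mul g h

variable {F m₁ m₂}

/-- The first component of the Levi projection is the upper-left block. [folklore] -/
@[simp] theorem coe_levi_fst (g : parabolic F m₁ m₂) :
    ((levi F m₁ m₂ g).1 : Matrix m₁ m₁ F) = ((g : GL (m₁ ⊕ m₂) F) : Matrix (m₁ ⊕ m₂) (m₁ ⊕ m₂) F).toBlocks₁₁ :=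
  IsUnit.unit_spec _

/-- The second component of the Levi projection is the lower-right block. [folklore] -/
@[simp] theorem coe_levi_snd (g : parabolic F m₁ m₂) :
    ((levi F m₁ m₂ g).2 : Matrix m₂ m₂ F) = ((g : GL (m₁ ⊕ m₂) F) : Matrix (m₁ ⊕ m₂) (m₁ ⊕ m₂) F).toBlocks₂₂ :=
  IsUnit.unit_spec _

/-- The block-diagonal matrix `(A 0; 0 D)` with invertible `A`, `D` is invertible. [folklore] -/
theorem isUnit_fromBlocks_diag (a : GL m₁ F) (d : GL m₂ F) :
    IsUnit (fromBlocks (a : Matrix m₁ m₁ F) 0 0 (d : Matrix m₂ m₂ F)) :=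
  isUnit_fromBlocks_zero₂₁.mpr ⟨Units.isUnit a, Units.isUnit d⟩

/-- The block-diagonal embedding `(A, D) ↦ (A 0; 0 D)` lands in the parabolic. [folklore] -/
theorem unit_fromBlocks_diag_mem (a : GL m₁ F) (d : GL m₂ F) :
    (isUnit_fromBlocks_diag a d).unit ∈ parabolic F m₁ m₂ := by
  rw [mem_parabolic_iff, IsUnit.unit_spec, toBlocks_fromBlocks₂₁]

/-- **The Levi projection is surjective** (split by the block-diagonal embedding). [folklore] -/
theorem levi_surjective : Function.Surjective (levi F m₁ m₂) := by
  rintro ⟨a, d⟩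
  refine ⟨⟨(isUnit_fromBlocks_diag a d).unit, unit_fromBlocks_diag_mem a d⟩, ?_⟩
  refine Prod.ext (Units.ext ?_) (Units.ext ?_)
  · rw [coe_levi_fst]
    show (((isUnit_fromBlocks_diag a d).unit : GL (m₁ ⊕ m₂) F) : Matrix (m₁ ⊕ m₂) (m₁ ⊕ m₂) F).toBlocks₁₁ = a
    rw [IsUnit.unit_spec, toBlocks_fromBlocks₁₁]
  · rw [coe_levi_snd]
    show (((isUnit_fromBlocks_diag a d).unit : GL (m₁ ⊕ m₂) F) : Matrix (m₁ ⊕ m₂) (m₁ ⊕ m₂) F).toBlocks₂₂ = d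
    rw [IsUnit.unit_spec, toBlocks_fromBlocks₂₂]

/-- **The kernel of the Levi projection is the unipotent radical** `U = {(1 B; 0 1)}`: an element
of the parabolic lies in the kernel iff its diagonal blocks are identity matrices. [folklore] -/
theorem mem_ker_levi_iff (g : parabolic F m₁ m₂) :
    g ∈ (levi F m₁ m₂).ker ↔
      ((g : GL (m₁ ⊕ m₂) F) : Matrix (m₁ ⊕ m₂) (m₁ ⊕ m₂) F).toBlocks₁₁ = 1 ∧
        ((g : GL (m₁ ⊕ m₂) F) : Matrix (m₁ ⊕ m₂) (m₁ ⊕ m₂) F).toBlocks₂₂ = 1 := by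
  rw [MonoidHom.mem_ker, Prod.ext_iff, Units.ext_iff, Units.ext_iff, coe_levi_fst, coe_levi_snd]
  rfl

/-- Block form of an element of the unipotent radical: `u = (1 B; 0 1)` with `B = u₁₂`. [folklore] -/
theorem coe_eq_fromBlocks_of_mem_ker {g : parabolic F m₁ m₂} (hg : g ∈ (levi F m₁ m₂).ker) :
    ((g : GL (m₁ ⊕ m₂) F) : Matrix (m₁ ⊕ m₂) (m₁ ⊕ m₂) F) =
      fromBlocks 1 ((g : GL (m₁ ⊕ m₂) F) : Matrix (m₁ ⊕ m₂) (m₁ ⊕ m₂) F).toBlocks₁₂ 0 1 := by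
  obtain ⟨h1, h2⟩ := (mem_ker_levi_iff g).mp hg
  conv_lhs => rw [coe_eq_fromBlocks g]
  rw [h1, h2]

/-- The unipotent matrix `(1 B; 0 1)` is invertible. [folklore] -/
theorem isUnit_fromBlocks_unipotent (B : Matrix m₁ m₂ F) :
    IsUnit (fromBlocks (1 : Matrix m₁ m₁ F) B 0 (1 : Matrix m₂ m₂ F)) :=
  isUnit_fromBlocks_zero₂₁.mpr ⟨isUnit_one, isUnit_one⟩

/-- `(1 B; 0 1)` lies in the parabolic. [folklore] -/
theorem unit_fromBlocks_unipotent_mem (B : Matrix m₁ m₂ F) :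
    (isUnit_fromBlocks_unipotent B).unit ∈ parabolic F m₁ m₂ := by
  rw [mem_parabolic_iff, IsUnit.unit_spec, toBlocks_fromBlocks₂₁]

/-- `(1 B; 0 1)`, as an element of the parabolic, lies in the kernel of the Levi projection. [folklore] -/
theorem unit_fromBlocks_unipotent_mem_ker (B : Matrix m₁ m₂ F) :
    (⟨(isUnit_fromBlocks_unipotent B).unit, unit_fromBlocks_unipotent_mem B⟩ : parabolic F m₁ m₂) ∈
      (levi F m₁ m₂).ker := by
  rw [mem_ker_levi_iff]
  constructor
  · show (((isUnit_fromBlocks_unipotent B).unit : GL (m₁ ⊕ m₂) F) : Matrix (m₁ ⊕ m₂) (m₁ ⊕ m₂) F).toBlocks₁₁ = 1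
    rw [IsUnit.unit_spec, toBlocks_fromBlocks₁₁]
  · show (((isUnit_fromBlocks_unipotent B).unit : GL (m₁ ⊕ m₂) F) : Matrix (m₁ ⊕ m₂) (m₁ ⊕ m₂) F).toBlocks₂₂ = 1
    rw [IsUnit.unit_spec, toBlocks_fromBlocks₂₂]

variable (F m₁ m₂)

/-- **The unipotent radical is in bijection with the matrices `B`**: `u ↦ u₁₂`, `B ↦ (1 B; 0 1)`.
[folklore] -/
def kerLeviEquiv : (levi F m₁ m₂).ker ≃ Matrix m₁ m₂ F where
  toFun u := (((u : parabolic F m₁ m₂) : GL (m₁ ⊕ m₂) F) : Matrix (m₁ ⊕ m₂) (m₁ ⊕ m₂) F).toBlocks₁₂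
  invFun B := ⟨⟨(isUnit_fromBlocks_unipotent B).unit, unit_fromBlocks_unipotent_mem B⟩,
    unit_fromBlocks_unipotent_mem_ker B⟩
  left_inv u := by
    refine Subtype.ext (Subtype.ext (Units.ext ?_))
    show (((isUnit_fromBlocks_unipotent _).unit : GL (m₁ ⊕ m₂) F) : Matrix (m₁ ⊕ m₂) (m₁ ⊕ m₂) F) = _
    rw [IsUnit.unit_spec, ← coe_eq_fromBlocks_of_mem_ker u.2]
  right_inv B := by
    show (((isUnit_fromBlocks_unipotent B).unit : GL (m₁ ⊕ m₂) F) : Matrix (m₁ ⊕ m₂) (m₁ ⊕ m₂) F).toBlocks₁₂ = B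
    rw [IsUnit.unit_spec, toBlocks_fromBlocks₁₂]

/-- **Order of the unipotent radical**: `|U| = |F|^{|m₁| · |m₂|}` (as `Nat.card`; meaningful for
finite `F`). [folklore] -/
theorem card_ker_levi :
    Nat.card (levi F m₁ m₂).ker = Nat.card F ^ (Nat.card m₁ * Nat.card m₂) := by
  rw [Nat.card_congr (kerLeviEquiv F m₁ m₂)]
  show Nat.card (m₁ → m₂ → F) = _
  rw [Nat.card_fun, Nat.card_fun, ← pow_mul, mul_comm]

/-- **Order of the parabolic**: `|P| = |U| · |GL(m₁, F)| · |GL(m₂, F)|`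
(`levi` is surjective with kernel `U`). [folklore] -/
theorem card_parabolic :
    Nat.card (parabolic F m₁ m₂) =
      Nat.card F ^ (Nat.card m₁ * Nat.card m₂) * (Nat.card (GL m₁ F) * Nat.card (GL m₂ F)) := by
  rw [← card_ker_levi F m₁ m₂, ← Nat.card_prod, ← Subgroup.card_top (G := GL m₁ F × GL m₂ F),
    ← MonoidHom.range_eq_top_of_surjective _ (levi_surjective (F := F) (m₁ := m₁) (m₂ := m₂)),
    ← Subgroup.index_ker, Subgroup.card_mul_index]

/-! ### Transport along a bijection of index types -/

/-- Reindexing invertible matrices along `e : m ≃ m'` is a group isomorphism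
`GL(m, F) ≃* GL(m', F)` (Mathlib `Matrix.reindexAlgEquiv` on units). [folklore] -/
def reindex {m m' : Type*} [Fintype m] [Fintype m'] [DecidableEq m] [DecidableEq m'] (e : m ≃ m') :
    GL m F ≃* GL m' F :=
  Units.mapEquiv (Matrix.reindexAlgEquiv F F e).toMulEquiv

variable {F}

/-- The underlying matrix of a reindexed element: `(reindex e g) = (g.submatrix e⁻¹ e⁻¹)`. [folklore] -/
@[simp] theorem coe_reindex {m m' : Type*} [Fintype m] [Fintype m'] [DecidableEq m] [DecidableEq m']
    (e : m ≃ m') (g : GL m F) :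
    ((reindex F e g : GL m' F) : Matrix m' m' F) = Matrix.reindex e e (g : Matrix m m F) :=
  rfl

end GLBlock

end Literature.RepresentationTheory.FiniteGroups

end
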